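import Literature.RingTheory.FittingIdeal.FittingLemma
import Mathlib.RingTheory.Finiteness.Cardinality
import Mathlib.RingTheory.Ideal.Maps
import HarnessLib

/-!
# Fitting ideals of ideals along ring homomorphisms

For a ring homomorphism `σ : A → A'` and a finitely generated ideal `I ⊆ A` with extension
`I' = I A'` (the image ideal when `σ` is surjective), the zeroth Fitting ideal of the `A`-module
`I` maps into the zeroth Fitting ideal of the `A'`-module `I'`: `σ(Fit_A(I)) ⊆ Fit_{A'}(I')`
(`map_fittingIdeal_le_fittingIdeal_of_map_eq`). Indeed generators `x₁, …, xₙ` of `I` map to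
generators of `I'`, relations among them map to relations, and determinants of relation
matrices map to determinants (Fitting's lemma, `Module.fittingIdeal_eq_relMinorIdeal`, makes
`Fit₀` computable from any one generating family). This is the residual form of the base-change
property `Fit_B(M ⊗_A B) = Fit_A(M) B` (de Smit–Rubin–Schoof, *Criteria for complete
intersections*, Prop. 1.1 (ii); Eisenbud, *Commutative Algebra*, Cor. 20.5) combined with the
surjection `I ⊗_A A' ↠ I A'`, in the form used twice in the proof of their Criterion I (§3,
p. 353: "`Fit_k(I_R ⊗_O k)` is the image in `R ⊗_O k` of `Fit_R(I_R)`"): passing from an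
augmented algebra `R` to `R/𝔪_O R` and to `R/𝔪_R K`. Everything here is proved; no definitions,
no named facts.

## References

* D. Eisenbud, *Commutative Algebra with a View Toward Algebraic Geometry*, GTM 150, Cor. 20.5.
  [Eisenbud1995]
* B. de Smit, K. Rubin, R. Schoof, *Criteria for complete intersections*, in: Modular Forms and
  Fermat's Last Theorem, Springer 1997, Prop. 1.1 (ii) and §3, p. 353. [DeSmitRubinSchoof1997]
-/

namespace Literature.RingTheory.FittingIdeal

universe u v

variable {A : Type u} {A' : Type v} [CommRing A] [CommRing A']

/-- Generators of an ideal `I`, viewed in the module `↥I`, from generators of `I` in `A`.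
[folklore] -/
theorem span_eq_top_of_span_eq {n : ℕ} {I : Ideal A} (s : Fin n → A)
    (hs : Ideal.span (Set.range s) = I) :
    Submodule.span A (Set.range fun i => (⟨s i, hs ▸ Ideal.subset_span ⟨i, rfl⟩⟩ : I)) = ⊤ := by
  apply Submodule.map_injective_of_injective I.injective_subtype
  rw [Submodule.map_span, Submodule.map_top, Submodule.range_subtype, ← Set.range_comp]
  exact hs

/-- **`σ(Fit_A(I)) ⊆ Fit_{A'}(I A')` for a ring homomorphism `σ : A → A'`** and a finitely
generated ideal `I` with extension `I' = I A'` (the image in `A'` of the Fitting ideal of `I` is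
contained in the Fitting ideal of the extended ideal; de Smit–Rubin–Schoof Prop. 1.1 (ii) with
the surjection `I ⊗_A A' ↠ I A'`; no surjectivity of `σ` is needed).
[cite: DeSmitRubinSchoof1997, Prop. 1.1 (ii)] -/
theorem map_fittingIdeal_le_fittingIdeal_of_map_eq (σ : A →+* A')
    {I : Ideal A} (hI : I.FG) {I' : Ideal A'} (hII' : I.map σ = I') :
    (Module.fittingIdeal A I 0).map σ ≤ Module.fittingIdeal A' I' 0 := by
  classical
  -- generators of `I` and their images, generators of `I'`
  obtain ⟨n, s, hs⟩ := Submodule.fg_iff_exists_fin_generating_family.mp hI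
  set x : Fin n → I := fun i => ⟨s i, hs ▸ Ideal.subset_span ⟨i, rfl⟩⟩ with hx
  have hxtop : Submodule.span A (Set.range x) = ⊤ := span_eq_top_of_span_eq s hs
  have hs' : ∀ i, σ (s i) ∈ I' := fun i =>
    hII' ▸ Ideal.mem_map_of_mem σ (hs ▸ Ideal.subset_span ⟨i, rfl⟩)
  set x' : Fin n → I' := fun i => ⟨σ (s i), hs' i⟩ with hx'
  have hx'top : Submodule.span A' (Set.range x') = ⊤ := by
    have hspan : Ideal.span (Set.range fun i => σ (s i)) = I' := by
      rw [← hII', ← hs, Ideal.map_span, ← Set.range_comp]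
      rfl
    exact span_eq_top_of_span_eq (fun i => σ (s i)) hspan
  rw [Module.fittingIdeal_eq_relMinorIdeal x hxtop 0, Module.fittingIdeal_eq_relMinorIdeal x'
    hx'top 0, Nat.sub_zero, Ideal.map_le_iff_le_comap, Module.relMinorIdeal_le_iff]
  intro ρ τ hρ
  rw [Ideal.mem_comap, RingHom.map_det]
  -- the image matrix is a relation matrix among the `x'`
  have hρ' : ∀ i, ∑ l, σ (ρ i l) • x' l = 0 := fun i => by
    apply Subtype.ext
    have h := congrArg (fun y : I => σ (y : A)) (hρ i)
    simp only [Submodule.coe_sum, Submodule.coe_smul, smul_eq_mul, map_sum,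
      map_mul, ZeroMemClass.coe_zero, map_zero] at h
    simpa [hx', Submodule.coe_sum] using h
  have hmat : σ.mapMatrix (Matrix.of fun i i' => ρ i (τ i')) =
      Matrix.of fun i i' => σ (ρ i (τ i')) := by
    ext i j
    rfl
  rw [hmat]
  exact Module.det_mem_relMinorIdeal x' (fun i l => σ (ρ i l)) hρ' τ

end Literature.RingTheory.FittingIdeal
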